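import Literature.AlgebraicGeometry.PlaneCurves.HessePencilHessian
import HarnessLib

/-!
# The Hessian group acting on the Hesse pencil: the generators `g₀, …, g₄` (Artebani–Dolgachev §4)

Topic `Literature/AlgebraicGeometry/PlaneCurves`, namespace `Literature.AlgebraicGeometry.PlaneCurves`.
Lane `lit-hodgefound`, seat `lit-hodgefound-p37`, row g18-#5; a one-file sequel of
`HessePencilHessian` / `HessePencilWeierstrassForm` (the member `H_μ = X³ + Y³ + Z³ − 3μXYZ`) in
the lane's vocabulary of projectivities (`PlaneCubicFlexTransitive`: a coordinate transformation is
an `M ∈ GL₃(K)` acting on forms by `F ↦ F ∘ M := bind₁ M.toMvPolynomial F`).  Everything here is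
PROVED (polynomial identities); no definition, no named fact.

Source followed — M. Artebani, I. Dolgachev, *The Hesse pencil of plane cubic curves*,
L'Enseignement Math. (2) 55 (2009) 235–273 [arXiv:math/0611590, held `paper:arxiv-math_0611590`
p0008 L1–L41, L54], §4 "The Hessian group", VERBATIM:

> The Hessian group is the subgroup `G₂₁₆` of `Aut(ℙ²) ≅ PGL(3, ℂ)` preserving the Hesse pencil.
> The Hessian group acts on the space `ℙ¹` of parameters of the Hesse pencil, hence defines a
> homomorphism `α : G₂₁₆ → Aut(ℙ¹)`. Its kernel `K` is generated by the transformations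
> `g₀(x, y, z) = (x, z, y)`, `g₁(x, y, z) = (y, z, x)`, `g₂(x, y, z) = (x, εy, ε²z)` […]
> In order to see it, it is enough to exhibit transformations from `G₂₁₆` which are mapped to
> generators of `A₄` of orders `2` and `3`. Here they are
> `g₃ = [[1, 1, 1], [1, ε, ε²], [1, ε², ε]]`, `g₄ = [[1, 0, 0], [0, ε, 0], [0, 0, ε]]`.
> The group generated by `g₀, g₃, g₄` is a central extension of degree two of `A₄`. […] Note that
> `g₃² = g₀` so `G₂₁₆ = ⟨g₁, g₂, g₃, g₄⟩`. […] (§4, after Prop. 4.1) The stabilizer subgroup of the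
> point `p₀` […] coincides with `⟨g₃, g₄⟩`.
> (§4, before the generators) Note that it leaves the zeroes of the binary forms `A(t₀, t₁)`,
> `B(t₀, t₁)` from (4) invariant.

## Dictionary

* `ε` is an `ω ∈ K` with `ω² + ω + 1 = 0` (then `ω³ = 1`); the five matrices are written out
  (`Matrix.of ![…]`; local notations `𝐠₀, …, 𝐠₄`, no definitions).
* "`g` preserves the member `E`" / "`g` maps `E_λ` to `E_λ′`" is the identity of forms
  `H_μ ∘ g = c · H_{μ′}` (`bind₁ g.toMvPolynomial 𝐇[μ] = c • 𝐇[μ′]`, `c ≠ 0`), i.e. the induced map on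
  the parameter line is `μ ↦ μ′`; with `H_μ = E_{−3μ}` the parameter `μ = 1, ω, ω²` are the three
  triangles `E_{−3}, E_{−3ε}, E_{−3ε²}` and `XYZ` is `E_∞`.
* "`g₃² = g₀`" in `PGL₃` is the matrix identity `g₃² = 3·g₀`.

## What is here

* §1 **The kernel**: `hesse_bind₁_g₀`, `hesse_bind₁_g₁` (any field, any `μ`: `H_μ ∘ g = H_μ`),
  `hesse_bind₁_g₂` (`ω³ = 1`: `H_μ ∘ g₂ = H_μ`) — `g₀, g₁, g₂` fix EVERY member.
* §2 **`g₄` and `g₃` move the parameter**: `hesse_bind₁_g₄` — `H_μ ∘ g₄ = H_{ω²μ}` (`ω³ = 1`);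
  **`hesse_bind₁_g₃`** — `H_μ ∘ g₃ = (3 − 3μ)(X³ + Y³ + Z³) + (18 + 9μ)XYZ` (`ω² + ω + 1 = 0`),
  hence (`hesse_bind₁_g₃_eq_smul`, `μ ≠ 1`, `3 ≠ 0`) `H_μ ∘ g₃ = (3 − 3μ) · H_{(μ+2)/(μ−1)}`: on
  parameters `g₃` acts by the involution `μ ↦ (μ + 2)/(μ − 1)` (`moebius_g₃_involutive`), and
  `hesse_bind₁_g₃_one` — the triangle `H₁ = E_{−3}` goes to `27·XYZ = E_∞`.
* §3 **The matrices**: `g₃_sq` — **`g₃² = 3·g₀`** ("Note that `g₃² = g₀`"); `det_g₃` (`= 3ω(ω − 1)`,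
  so `g₃ ∈ GL₃` when `3 ≠ 0`, `det_g₃_ne_zero`); `g₀_sq_and_g₁_pow_three` (`g₀² = 1`, `g₁³ = 1`),
  `g₂_pow_three_and_g₄_pow_three` (`g₂³ = g₄³ = 1`); and **the stabilizer of `p₀`**:
  `g₃_g₄_mulVec_p₀` (`g₃p₀ = (ω − ω²)·p₀`, `g₄p₀ = ω·p₀`) — `g₃, g₄` fix the base point
  `p₀ = (0, 1, −1)`.
* §4 **"it leaves the zeroes of the binary forms `A`, `B` invariant"** — the induced maps on
  parameters preserve the three special parameter sets of `HessePencilWeierstrassForm` /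
  `HessePencilHarmonicMembers` (triangles `μ³ = 1`, equianharmonic `μ(μ³ + 8) = 0`, harmonic
  `μ⁶ − 20μ³ − 8 = 0`): for `g₄` trivially (`(ω²μ)³ = μ³`, `g₄_parameter_cubes`); for `g₃`
  (`t = (μ+2)/(μ−1)`, `μ ≠ 1`): `moebius_g₃_pow_three_sub_one` (`t³ − 1 = 9(μ² + μ + 1)/(μ−1)³` — a
  triangle `μ ∈ {ω, ω²}` goes to a triangle, and `μ = 1` to `E_∞`), `moebius_g₃_equianharmonic`
  (`t(t³ + 8) = 9μ(μ³ + 8)/(μ−1)⁴`), `moebius_g₃_harmonic`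
  (`t⁶ − 20t³ − 8 = −27(μ⁶ − 20μ³ − 8)/(μ−1)⁶`).

NOT here: that `G₂₁₆` IS the full stabiliser of the pencil in `PGL₃` and has order `216`
(Prop. 4.1, `Γ ⋊ SL(2, 𝔽₃)`), the translations interpretation of `g₁, g₂`, the permutation
representation `T, U` on the nine base points, the reflection groups and their invariants
`Φ₆, Φ₉, Φ₁₂, Φ₁₈` (a sequel row).

## References
* [ArtebaniDolgachev2009] M. Artebani, I. Dolgachev, *The Hesse pencil of plane cubic curves*,
  Enseign. Math. (2) 55 (2009) 235–273, §4 (the Hessian group: `g₀, …, g₄`, `g₃² = g₀`, the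
  stabilizer of `p₀`).
* [Knapp1992] A. W. Knapp, *Elliptic Curves*, Princeton 1992, §II.2 (`F^Φ = F ∘ Φ⁻¹`, the action of
  projectivities on forms).
-/

set_option autoImplicit false

open MvPolynomial Matrix

namespace Literature.AlgebraicGeometry.PlaneCurves

universe u

/-- The Hesse cubic `H_μ = X³ + Y³ + Z³ − 3μXYZ` (local notation as in the statements of
`HessePencilWeierstrassForm`, no definition). -/
local notation3 "𝐇[" μ "]" =>
  (X 0 ^ 3 + X 1 ^ 3 + X 2 ^ 3 - C (3 * μ) * (X 0 * X 1 * X 2) : MvPolynomial (Fin 3) _)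

/-- `g₀(x, y, z) = (x, z, y)` (local notation, no definition). -/
local notation3 "𝐠₀" => (Matrix.of ![![(1 : _), 0, 0], ![0, 0, 1], ![0, 1, 0]] : Matrix (Fin 3) (Fin 3) _)

/-- `g₁(x, y, z) = (y, z, x)` (local notation, no definition). -/
local notation3 "𝐠₁" => (Matrix.of ![![(0 : _), 1, 0], ![0, 0, 1], ![1, 0, 0]] : Matrix (Fin 3) (Fin 3) _)

/-- `g₂(x, y, z) = (x, εy, ε²z)` (local notation, no definition). -/
local notation3 "𝐠₂[" ω "]" =>
  (Matrix.of ![![(1 : _), 0, 0], ![0, ω, 0], ![0, 0, ω ^ 2]] : Matrix (Fin 3) (Fin 3) _)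

/-- `g₃ = [[1, 1, 1], [1, ε, ε²], [1, ε², ε]]` (local notation, no definition). -/
local notation3 "𝐠₃[" ω "]" =>
  (Matrix.of ![![(1 : _), 1, 1], ![1, ω, ω ^ 2], ![1, ω ^ 2, ω]] : Matrix (Fin 3) (Fin 3) _)

/-- `g₄ = diag(1, ε, ε)` (local notation, no definition). -/
local notation3 "𝐠₄[" ω "]" =>
  (Matrix.of ![![(1 : _), 0, 0], ![0, ω, 0], ![0, 0, ω]] : Matrix (Fin 3) (Fin 3) _)

section HessianGroup

variable {K : Type u} [Field K]

/-- The linear forms of a `3 × 3` substitution, written out. [folklore] -/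
private theorem toMvPolynomial_fin_three_hg (M : Matrix (Fin 3) (Fin 3) K) (i : Fin 3) :
    M.toMvPolynomial i = C (M i 0) * X 0 + C (M i 1) * X 1 + C (M i 2) * X 2 := by
  simp only [Matrix.toMvPolynomial, Fin.sum_univ_three, ← C_mul_X_eq_monomial]

/-- `H_μ ∘ M` written out in the rows of `M`. [cite: Knapp1992, §II.2 (`F^Φ = F ∘ Φ⁻¹`)] -/
private theorem bind₁_hesse (M : Matrix (Fin 3) (Fin 3) K) (μ : K) :
    bind₁ M.toMvPolynomial 𝐇[μ] =
      (C (M 0 0) * X 0 + C (M 0 1) * X 1 + C (M 0 2) * X 2) ^ 3 +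
        (C (M 1 0) * X 0 + C (M 1 1) * X 1 + C (M 1 2) * X 2) ^ 3 +
        (C (M 2 0) * X 0 + C (M 2 1) * X 1 + C (M 2 2) * X 2) ^ 3 -
      C (3 * μ) * ((C (M 0 0) * X 0 + C (M 0 1) * X 1 + C (M 0 2) * X 2) *
        (C (M 1 0) * X 0 + C (M 1 1) * X 1 + C (M 1 2) * X 2) *
        (C (M 2 0) * X 0 + C (M 2 1) * X 1 + C (M 2 2) * X 2)) := by
  simp only [map_sub, map_add, map_mul, map_pow, bind₁_X_right, bind₁_C_right,
    toMvPolynomial_fin_three_hg]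

/-- `C ω ^ 3 = 1` in `K[X, Y, Z]` from `ω² + ω + 1 = 0`. [folklore] -/
private theorem C_omega_pow_three {ω : K} (hω : ω ^ 2 + ω + 1 = 0) :
    (C ω : MvPolynomial (Fin 3) K) ^ 3 = 1 := by
  rw [← C_pow, show ω ^ 3 = 1 by linear_combination (ω - 1) * hω, C_1]

/-- `C ω² + C ω + 1 = 0` in `K[X, Y, Z]`. [folklore] -/
private theorem C_omega_rel {ω : K} (hω : ω ^ 2 + ω + 1 = 0) :
    (C ω : MvPolynomial (Fin 3) K) ^ 2 + C ω + 1 = 0 := by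
  rw [← C_pow, ← C_add, ← C_1, ← C_add, hω, C_0]

/-! ## §1 The kernel: `g₀, g₁, g₂` fix every member of the pencil -/

/-- **`g₀(x, y, z) = (x, z, y)` preserves every member**: `H_μ ∘ g₀ = H_μ` (any field).
[cite: ArtebaniDolgachev2009, §4 (the kernel `K = ⟨g₀, g₁, g₂⟩` of `α`)] -/
theorem hesse_bind₁_g₀ (μ : K) : bind₁ (𝐠₀ : Matrix (Fin 3) (Fin 3) K).toMvPolynomial 𝐇[μ] = 𝐇[μ] := by
  rw [bind₁_hesse]
  simp
  ring

/-- **`g₁(x, y, z) = (y, z, x)` preserves every member**: `H_μ ∘ g₁ = H_μ` (any field).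
[cite: ArtebaniDolgachev2009, §4 (the kernel `K = ⟨g₀, g₁, g₂⟩` of `α`)] -/
theorem hesse_bind₁_g₁ (μ : K) : bind₁ (𝐠₁ : Matrix (Fin 3) (Fin 3) K).toMvPolynomial 𝐇[μ] = 𝐇[μ] := by
  rw [bind₁_hesse]
  simp
  ring

/-- **`g₂(x, y, z) = (x, εy, ε²z)` preserves every member**: `H_μ ∘ g₂ = H_μ` for
`ω² + ω + 1 = 0`. [cite: ArtebaniDolgachev2009, §4 (the kernel `K = ⟨g₀, g₁, g₂⟩` of `α`)] -/
theorem hesse_bind₁_g₂ (μ : K) {ω : K} (hω : ω ^ 2 + ω + 1 = 0) :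
    bind₁ (𝐠₂[ω] : Matrix (Fin 3) (Fin 3) K).toMvPolynomial 𝐇[μ] = 𝐇[μ] := by
  rw [bind₁_hesse]
  simp only [Matrix.of_apply, Matrix.cons_val_zero, Matrix.cons_val_one, Matrix.cons_val_two,
    Matrix.head_cons, Matrix.tail_cons, map_one, map_zero, one_mul, zero_mul, add_zero, zero_add,
    map_pow, map_mul, map_ofNat]
  linear_combination (X 1 ^ 3 + (C ω ^ 3 + 1) * X 2 ^ 3 - 3 * C μ * (X 0 * X 1 * X 2) :
    MvPolynomial (Fin 3) K) * C_omega_pow_three hω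

/-! ## §2 `g₄` and `g₃` act on the parameter -/

/-- **`g₄ = diag(1, ε, ε)` maps `E_λ` to `E_{ε²λ}`**: `H_μ ∘ g₄ = H_{ω²μ}` for `ω² + ω + 1 = 0` —
on parameters `g₄` acts by `μ ↦ ω²μ`, of order `3` ("generators of `A₄` of orders `2` and `3`").
[cite: ArtebaniDolgachev2009, §4 (the generator `g₄`)] -/
theorem hesse_bind₁_g₄ (μ : K) {ω : K} (hω : ω ^ 2 + ω + 1 = 0) :
    bind₁ (𝐠₄[ω] : Matrix (Fin 3) (Fin 3) K).toMvPolynomial 𝐇[μ] = 𝐇[ω ^ 2 * μ] := by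
  rw [bind₁_hesse]
  simp only [Matrix.of_apply, Matrix.cons_val_zero, Matrix.cons_val_one, Matrix.cons_val_two,
    Matrix.head_cons, Matrix.tail_cons, map_one, map_zero, one_mul, zero_mul, add_zero, zero_add,
    map_pow, map_mul, map_ofNat]
  linear_combination (X 1 ^ 3 + X 2 ^ 3 : MvPolynomial (Fin 3) K) * C_omega_pow_three hω

/-- **`g₃` maps `H_μ` to `(3 − 3μ)(X³ + Y³ + Z³) + (18 + 9μ)XYZ`** (`ω² + ω + 1 = 0`; from
`(x+y+z)³ + (x+εy+ε²z)³ + (x+ε²y+εz)³ = 3(x³ + y³ + z³) + 18xyz` and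
`(x+y+z)(x+εy+ε²z)(x+ε²y+εz) = x³ + y³ + z³ − 3xyz`).
[cite: ArtebaniDolgachev2009, §4 (the generator `g₃`)] -/
theorem hesse_bind₁_g₃ (μ : K) {ω : K} (hω : ω ^ 2 + ω + 1 = 0) :
    bind₁ (𝐠₃[ω] : Matrix (Fin 3) (Fin 3) K).toMvPolynomial 𝐇[μ] =
      C (3 - 3 * μ) * (X 0 ^ 3 + X 1 ^ 3 + X 2 ^ 3) + C (18 + 9 * μ) * (X 0 * X 1 * X 2) := by
  rw [bind₁_hesse]
  simp only [Matrix.of_apply, Matrix.cons_val_zero, Matrix.cons_val_one, Matrix.cons_val_two,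
    Matrix.head_cons, Matrix.tail_cons, map_one, one_mul, map_pow, map_mul, map_sub, map_add,
    map_ofNat]
  linear_combination (-3 * X 0 ^ 2 * X 1 * C μ + 3 * X 0 ^ 2 * X 1 - 3 * X 0 ^ 2 * X 2 * C μ +
    3 * X 0 ^ 2 * X 2 + 3 * X 0 * X 1 ^ 2 * C ω ^ 2 - 3 * X 0 * X 1 ^ 2 * C ω * C μ -
    3 * X 0 * X 1 ^ 2 * C ω + 3 * X 0 * X 1 ^ 2 - 3 * X 0 * X 1 * X 2 * C ω ^ 2 * C μ +
    3 * X 0 * X 1 * X 2 * C ω * C μ + 12 * X 0 * X 1 * X 2 * C ω - 9 * X 0 * X 1 * X 2 * C μ -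
    12 * X 0 * X 1 * X 2 + 3 * X 0 * X 2 ^ 2 * C ω ^ 2 - 3 * X 0 * X 2 ^ 2 * C ω * C μ -
    3 * X 0 * X 2 ^ 2 * C ω + 3 * X 0 * X 2 ^ 2 + X 1 ^ 3 * C ω ^ 4 - X 1 ^ 3 * C ω ^ 3 -
    3 * X 1 ^ 3 * C ω * C μ + 2 * X 1 ^ 3 * C ω + 3 * X 1 ^ 3 * C μ - 2 * X 1 ^ 3 +
    3 * X 1 ^ 2 * X 2 * C ω ^ 3 - 3 * X 1 ^ 2 * X 2 * C ω ^ 2 * C μ - 3 * X 1 ^ 2 * X 2 * C ω +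
    3 * X 1 ^ 2 * X 2 + 3 * X 1 * X 2 ^ 2 * C ω ^ 3 - 3 * X 1 * X 2 ^ 2 * C ω ^ 2 * C μ -
    3 * X 1 * X 2 ^ 2 * C ω + 3 * X 1 * X 2 ^ 2 + X 2 ^ 3 * C ω ^ 4 - X 2 ^ 3 * C ω ^ 3 -
    3 * X 2 ^ 3 * C ω * C μ + 2 * X 2 ^ 3 * C ω + 3 * X 2 ^ 3 * C μ - 2 * X 2 ^ 3 :
    MvPolynomial (Fin 3) K) * C_omega_rel hω

/-- **On parameters `g₃` acts by `μ ↦ (μ + 2)/(μ − 1)`**: for `μ ≠ 1` (and `3 ≠ 0`, `ω² + ω + 1 = 0`),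
`H_μ ∘ g₃ = (3 − 3μ) · H_{(μ+2)/(μ−1)}` with `3 − 3μ ≠ 0`.
[cite: ArtebaniDolgachev2009, §4 (the homomorphism `α : G₂₁₆ → Aut(ℙ¹)`, the generator `g₃`)] -/
theorem hesse_bind₁_g₃_eq_smul (h3 : (3 : K) ≠ 0) {μ : K} (hμ : μ ≠ 1) {ω : K}
    (hω : ω ^ 2 + ω + 1 = 0) :
    bind₁ (𝐠₃[ω] : Matrix (Fin 3) (Fin 3) K).toMvPolynomial 𝐇[μ] =
      (3 - 3 * μ) • 𝐇[(μ + 2) / (μ - 1)] ∧ (3 - 3 * μ : K) ≠ 0 := by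
  have hμ1 : μ - 1 ≠ 0 := sub_ne_zero.2 hμ
  have hc : (3 - 3 * μ : K) ≠ 0 := by
    rw [show (3 - 3 * μ : K) = -3 * (μ - 1) by ring]
    exact mul_ne_zero (neg_ne_zero.2 h3) hμ1
  refine ⟨?_, hc⟩
  rw [hesse_bind₁_g₃ μ hω, smul_eq_C_mul]
  have e : (C (18 + 9 * μ) : MvPolynomial (Fin 3) K) =
      C (3 - 3 * μ) * -C (3 * ((μ + 2) / (μ - 1))) := by
    rw [← C_neg, ← C_mul]
    congr 1
    field_simp
    ring
  rw [e]
  ring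

/-- **`g₃` maps the triangle `E_{−3} = H₁` to the triangle `E_∞ = XYZ`**: `H₁ ∘ g₃ = 27·XYZ`
(`ω² + ω + 1 = 0`). [cite: ArtebaniDolgachev2009, §4 (the action of `α(G₂₁₆) ≅ A₄` on the four
triangles)] -/
theorem hesse_bind₁_g₃_one {ω : K} (hω : ω ^ 2 + ω + 1 = 0) :
    bind₁ (𝐠₃[ω] : Matrix (Fin 3) (Fin 3) K).toMvPolynomial 𝐇[(1 : K)] = C 27 * (X 0 * X 1 * X 2) := by
  rw [hesse_bind₁_g₃ 1 hω]
  have e1 : (C (3 - 3 * 1) : MvPolynomial (Fin 3) K) = 0 := by rw [mul_one, sub_self, C_0]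
  have e2 : (C (18 + 9 * 1) : MvPolynomial (Fin 3) K) = C 27 := by norm_num
  rw [e1, e2, zero_mul, zero_add]

/-- The induced map `μ ↦ (μ + 2)/(μ − 1)` is an involution away from `μ = 1`
("generators of `A₄` of orders `2` and `3`": `g₃` has order `2` on parameters, `g₃² = g₀ ∈ K`).
[cite: ArtebaniDolgachev2009, §4 (`g₃² = g₀`)] -/
theorem moebius_g₃_involutive (h3 : (3 : K) ≠ 0) {μ : K} (hμ : μ ≠ 1) :
    (μ + 2) / (μ - 1) ≠ 1 ∧ ((μ + 2) / (μ - 1) + 2) / ((μ + 2) / (μ - 1) - 1) = μ := by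
  have hμ1 : μ - 1 ≠ 0 := sub_ne_zero.2 hμ
  have ht : (μ + 2) / (μ - 1) - 1 = 3 / (μ - 1) := by
    field_simp
    ring
  have ht0 : (μ + 2) / (μ - 1) - 1 ≠ 0 := by
    rw [ht]
    exact div_ne_zero h3 hμ1
  refine ⟨fun h => ht0 (by rw [h, sub_self]), ?_⟩
  rw [div_eq_iff ht0, ht]
  field_simp
  ring

/-! ## §3 The matrices: `g₃² = 3·g₀`, orders, the stabilizer of `p₀` -/

/-- **"Note that `g₃² = g₀`"** (projectively): `g₃² = 3·g₀` for `ω² + ω + 1 = 0`.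
[cite: ArtebaniDolgachev2009, §4 (`g₃² = g₀`)] -/
theorem g₃_sq {ω : K} (hω : ω ^ 2 + ω + 1 = 0) :
    (𝐠₃[ω] : Matrix (Fin 3) (Fin 3) K) * 𝐠₃[ω] = (3 : K) • 𝐠₀ := by
  ext i j : 1
  fin_cases i <;> fin_cases j <;> simp [Matrix.mul_apply, Fin.sum_univ_three]
  · norm_num
  · linear_combination hω
  · linear_combination hω
  · linear_combination hω
  · linear_combination (ω ^ 2 - ω + 1) * hω
  · linear_combination (2 * (ω - 1)) * hω
  · linear_combination hω
  · linear_combination (2 * (ω - 1)) * hω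
  · linear_combination (ω ^ 2 - ω + 1) * hω

/-- `det g₃ = 3ω(ω − 1)` (`ω² + ω + 1 = 0`). [cite: ArtebaniDolgachev2009, §4 (the generator
`g₃ ∈ PGL(3)`)] -/
theorem det_g₃ {ω : K} (hω : ω ^ 2 + ω + 1 = 0) :
    (𝐠₃[ω] : Matrix (Fin 3) (Fin 3) K).det = 3 * ω * (ω - 1) := by
  rw [Matrix.det_fin_three]
  simp
  linear_combination (-(ω ^ 2) + ω) * hω

/-- `g₃` is invertible when `3 ≠ 0` (then `ω ≠ 0, 1`). [cite: ArtebaniDolgachev2009, §4] -/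
theorem det_g₃_ne_zero (h3 : (3 : K) ≠ 0) {ω : K} (hω : ω ^ 2 + ω + 1 = 0) :
    (𝐠₃[ω] : Matrix (Fin 3) (Fin 3) K).det ≠ 0 := by
  rw [det_g₃ hω]
  have hω0 : ω ≠ 0 := by
    rintro rfl
    norm_num at hω
  have hω1 : ω - 1 ≠ 0 := by
    intro h
    have h1 : ω = 1 := sub_eq_zero.1 h
    rw [h1] at hω
    exact h3 (by linear_combination hω)
  exact mul_ne_zero (mul_ne_zero h3 hω0) hω1

/-- `g₀² = 1`, `g₁³ = 1`. [cite: ArtebaniDolgachev2009, §4 (`Γ = ⟨g₁, g₂⟩ ≅ (ℤ/3ℤ)²`, `K` of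
index `2` over `Γ`)] -/
theorem g₀_sq_and_g₁_pow_three :
    (𝐠₀ : Matrix (Fin 3) (Fin 3) K) * 𝐠₀ = 1 ∧ (𝐠₁ : Matrix (Fin 3) (Fin 3) K) * 𝐠₁ * 𝐠₁ = 1 := by
  constructor
  · ext i j : 1
    fin_cases i <;> fin_cases j <;> simp [Matrix.mul_apply, Fin.sum_univ_three]
  · ext i j : 1
    fin_cases i <;> fin_cases j <;> simp [Matrix.mul_apply, Fin.sum_univ_three]

/-- `g₂³ = 1` and `g₄³ = 1` (`ω² + ω + 1 = 0`). [cite: ArtebaniDolgachev2009, §4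
(`Γ ≅ (ℤ/3ℤ)²`; `g₄` of order `3`)] -/
theorem g₂_pow_three_and_g₄_pow_three {ω : K} (hω : ω ^ 2 + ω + 1 = 0) :
    (𝐠₂[ω] : Matrix (Fin 3) (Fin 3) K) * 𝐠₂[ω] * 𝐠₂[ω] = 1 ∧
      (𝐠₄[ω] : Matrix (Fin 3) (Fin 3) K) * 𝐠₄[ω] * 𝐠₄[ω] = 1 := by
  have h3 : ω ^ 3 = 1 := by linear_combination (ω - 1) * hω
  constructor
  · ext i j : 1
    fin_cases i <;> fin_cases j <;> simp [Matrix.mul_apply, Fin.sum_univ_three]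
    · linear_combination h3
    · linear_combination (ω ^ 3 + 1) * h3
  · ext i j : 1
    fin_cases i <;> fin_cases j <;> simp [Matrix.mul_apply, Fin.sum_univ_three]
    · linear_combination h3
    · linear_combination h3

/-- **"The stabilizer subgroup of the point `p₀` … coincides with `⟨g₃, g₄⟩`"** — the containment
that is a computation: `g₃p₀ = (ω − ω²)·p₀` and `g₄p₀ = ω·p₀` for `p₀ = (0, 1, −1)`.
[cite: ArtebaniDolgachev2009, §4 (after Prop. 4.1)] -/
theorem g₃_g₄_mulVec_p₀ (ω : K) :
    (𝐠₃[ω] : Matrix (Fin 3) (Fin 3) K) *ᵥ ![0, 1, -1] = (ω - ω ^ 2) • ![0, 1, -1] ∧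
      (𝐠₄[ω] : Matrix (Fin 3) (Fin 3) K) *ᵥ ![0, 1, -1] = ω • ![0, 1, -1] := by
  constructor
  · funext i
    fin_cases i <;> simp [Matrix.mulVec, dotProduct, Fin.sum_univ_three] <;> ring
  · funext i
    fin_cases i <;> simp [Matrix.mulVec, dotProduct, Fin.sum_univ_three]

/-! ## §4 The special parameter sets are invariant -/

/-- `g₄` on parameters, `μ ↦ ω²μ`, preserves `μ³` (`ω³ = 1`), hence the three special sets
`μ³ = 1` (triangles), `μ(μ³ + 8) = 0` (equianharmonic, the zeroes of `A`), `μ⁶ − 20μ³ − 8 = 0`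
(harmonic, the zeroes of `B`). [cite: ArtebaniDolgachev2009, §4 ("it leaves the zeroes of the
binary forms `A(t₀, t₁), B(t₀, t₁)` invariant")] -/
theorem g₄_parameter_cubes (μ : K) {ω : K} (hω : ω ^ 2 + ω + 1 = 0) :
    (ω ^ 2 * μ) ^ 3 = μ ^ 3 ∧
      (ω ^ 2 * μ) * ((ω ^ 2 * μ) ^ 3 + 8) = ω ^ 2 * (μ * (μ ^ 3 + 8)) ∧
      (ω ^ 2 * μ) ^ 6 - 20 * (ω ^ 2 * μ) ^ 3 - 8 = μ ^ 6 - 20 * μ ^ 3 - 8 := by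
  have h3 : ω ^ 3 = 1 := by linear_combination (ω - 1) * hω
  refine ⟨?_, ?_, ?_⟩
  · linear_combination (ω ^ 3 + 1) * μ ^ 3 * h3
  · linear_combination (ω ^ 3 + 1) * ω ^ 2 * μ ^ 4 * h3
  · linear_combination ((ω ^ 9 + ω ^ 6 + ω ^ 3 + 1) * μ ^ 6 - 20 * (ω ^ 3 + 1) * μ ^ 3) * h3

/-- **`g₃` permutes the triangles**: with `t = (μ + 2)/(μ − 1)` (`μ ≠ 1`),
`t³ − 1 = 9(μ² + μ + 1)/(μ − 1)³`; so for `μ ∈ {ω, ω²}` (`μ² + μ + 1 = 0`) the image is again a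
triangle parameter, while `μ = 1` goes to `E_∞` (`hesse_bind₁_g₃_one`).
[cite: ArtebaniDolgachev2009, §4 (the action on the four triangles)] -/
theorem moebius_g₃_pow_three_sub_one {μ : K} (hμ : μ ≠ 1) :
    ((μ + 2) / (μ - 1)) ^ 3 - 1 = 9 * (μ ^ 2 + μ + 1) / (μ - 1) ^ 3 := by
  have hμ1 : μ - 1 ≠ 0 := sub_ne_zero.2 hμ
  field_simp
  ring

/-- **`g₃` preserves the zeroes of `A` (the equianharmonic members `μ(μ³ + 8) = 0`)**:
`t(t³ + 8) = 9μ(μ³ + 8)/(μ − 1)⁴` for `t = (μ + 2)/(μ − 1)`, `μ ≠ 1`.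
[cite: ArtebaniDolgachev2009, §4 ("it leaves the zeroes of the binary forms `A(t₀, t₁), B(t₀, t₁)`
invariant")] -/
theorem moebius_g₃_equianharmonic {μ : K} (hμ : μ ≠ 1) :
    (μ + 2) / (μ - 1) * (((μ + 2) / (μ - 1)) ^ 3 + 8) = 9 * (μ * (μ ^ 3 + 8)) / (μ - 1) ^ 4 := by
  have hμ1 : μ - 1 ≠ 0 := sub_ne_zero.2 hμ
  field_simp
  ring

/-- **`g₃` preserves the zeroes of `B` (the harmonic members `μ⁶ − 20μ³ − 8 = 0`)**:
`t⁶ − 20t³ − 8 = −27(μ⁶ − 20μ³ − 8)/(μ − 1)⁶` for `t = (μ + 2)/(μ − 1)`, `μ ≠ 1`.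
[cite: ArtebaniDolgachev2009, §4 ("it leaves the zeroes of the binary forms `A(t₀, t₁), B(t₀, t₁)`
invariant")] -/
theorem moebius_g₃_harmonic {μ : K} (hμ : μ ≠ 1) :
    ((μ + 2) / (μ - 1)) ^ 6 - 20 * ((μ + 2) / (μ - 1)) ^ 3 - 8 =
      -27 * (μ ^ 6 - 20 * μ ^ 3 - 8) / (μ - 1) ^ 6 := by
  have hμ1 : μ - 1 ≠ 0 := sub_ne_zero.2 hμ
  field_simp
  ring

end HessianGroup

end Literature.AlgebraicGeometry.PlaneCurves
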